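import Mathlib.Analysis.Calculus.BumpFunction.FiniteDimension
import Mathlib.Analysis.Calculus.Deriv.Mul
import Mathlib.Analysis.Calculus.ContDiff.Deriv
import Mathlib.MeasureTheory.Integral.IntervalIntegral.Basic
import Mathlib.MeasureTheory.Integral.DominatedConvergence
import HarnessLib

/-!
# Passing to the limit in a one-dimensional virial identity

(namespace `Literature.Analysis.FunctionSpaces`)

Folklore bookkeeping for limits of "slice data" on an interval `[0, L]`:

* `exists_contDiff_bounded_extension` : a `C¹` function on `ℝ` agrees on `[a, b]` (together with its
  derivative) with a BOUNDED `C¹` function with bounded derivative (cut off by a smooth bump), which is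
  nonnegative if the original is;
* `tendsto_setIntegral_mul_of_L1`, `tendsto_setIntegral_mul_of_uniform` : pairing with a bounded
  continuous weight is continuous under `L¹(0,L)` convergence, resp. uniform convergence on `[0,L]`;
* `virialIdentity_of_limit` : if `|∫ g Eₖ + ½ ∫ g' Pₖ - εₖ ∫ g Mₖ| ≤ ω(D, k) → 0` for all `C¹` tests
  with `|g| ≤ 1`, `|g'| ≤ D`, and `Eₖ → e`, `Pₖ → p` in `L¹(0,L)`, `Mₖ → m` uniformly, `εₖ → E'`, then
  the limit data satisfy the exact identity `∫ g e + ½ ∫ g' p = E' ∫ g m` for EVERY `C¹` test `g`;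
* `sliceBound_of_limit` : the analogous passage to the limit in `∫ g ETₖ + E₁ ∫ g Mₖ ≤ ∫ g Eₖ`
  (`0 ≤ g ≤ 1`), concluding for every nonnegative `C¹` test.

[folklore]
-/

noncomputable section

open MeasureTheory Filter Set Metric Function intervalIntegral
open scoped Topology

namespace Literature.Analysis.FunctionSpaces

/-! ### Bounded `C¹` modification outside an interval -/

/-- **Bounded `C¹` extension.** A `C¹` function `g : ℝ → ℝ` agrees on `[a, b]`, together with its
derivative, with a bounded `C¹` function `ĝ` with bounded derivative; `ĝ ≥ 0` if `g ≥ 0`. (Multiply by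
a smooth bump equal to `1` on a neighbourhood of `[a, b]`.) [folklore] -/
theorem exists_contDiff_bounded_extension (g : ℝ → ℝ) (hg : ContDiff ℝ 1 g) {a b : ℝ} (hab : a ≤ b) :
    ∃ ĝ : ℝ → ℝ, ContDiff ℝ 1 ĝ ∧ (∀ s ∈ Icc a b, ĝ s = g s) ∧ (∀ s ∈ Icc a b, deriv ĝ s = deriv g s) ∧
      (∃ C, 0 ≤ C ∧ ∀ s, |ĝ s| ≤ C) ∧ (∃ D, 0 ≤ D ∧ ∀ s, |deriv ĝ s| ≤ D) ∧
      ((∀ s, 0 ≤ g s) → ∀ s, 0 ≤ ĝ s) := by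
  set c : ℝ := (a + b) / 2 with hc
  let χ : ContDiffBump c :=
    { rIn := (b - a) / 2 + 1
      rOut := (b - a) / 2 + 2
      rIn_pos := by linarith
      rIn_lt_rOut := by linarith }
  set ĝ : ℝ → ℝ := fun s => χ s * g s with hĝ
  have hχ : ContDiff ℝ 1 (χ : ℝ → ℝ) := χ.contDiff
  have hĝd : ContDiff ℝ 1 ĝ := hχ.mul hg
  -- `χ = 1` on the open ball of radius `rIn`, a neighbourhood of `[a, b]`
  have hrIn : χ.rIn = (b - a) / 2 + 1 := rfl
  have hball : Icc a b ⊆ ball c χ.rIn := by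
    intro s hs
    rw [mem_ball, Real.dist_eq, abs_lt, hrIn]
    constructor <;> · simp only [hc]; linarith [hs.1, hs.2]
  have heqOn : ∀ s ∈ ball c χ.rIn, ĝ s = g s := by
    intro s hs
    simp only [hĝ, χ.one_of_mem_closedBall (ball_subset_closedBall hs), one_mul]
  have hsuppχ : HasCompactSupport (χ : ℝ → ℝ) := χ.hasCompactSupport
  have hsupp : HasCompactSupport ĝ := hsuppχ.mul_right
  refine ⟨ĝ, hĝd, fun s hs => heqOn s (hball hs), fun s hs => ?_, ?_, ?_, fun hg0 s => ?_⟩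
  · -- derivatives agree on the open ball
    refine Filter.EventuallyEq.deriv_eq ?_
    filter_upwards [isOpen_ball.mem_nhds (hball hs)] with x hx using heqOn x hx
  · obtain ⟨C, hC⟩ := (hĝd.continuous.norm).bddAbove_range_of_hasCompactSupport hsupp.norm
    refine ⟨max C 0, le_max_right _ _, fun s => ?_⟩
    have := hC (mem_range_self s)
    rw [Real.norm_eq_abs] at this
    exact this.trans (le_max_left _ _)
  · have hdc : Continuous (deriv ĝ) := hĝd.continuous_deriv le_rfl
    have hds : HasCompactSupport (deriv ĝ) := hsupp.deriv
    obtain ⟨D, hD⟩ := (hdc.norm).bddAbove_range_of_hasCompactSupport hds.norm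
    refine ⟨max D 0, le_max_right _ _, fun s => ?_⟩
    have := hD (mem_range_self s)
    rw [Real.norm_eq_abs] at this
    exact this.trans (le_max_left _ _)
  · exact mul_nonneg (χ.nonneg) (hg0 s)

/-! ### Pairings under `L¹` and uniform convergence -/

variable {L : ℝ}

/-- Pairing with a bounded continuous weight is continuous for `L¹(0,L)` convergence. [folklore] -/
theorem tendsto_setIntegral_mul_of_L1 (f : ℕ → ℝ → ℝ) (g : ℝ → ℝ)
    (hf : ∀ k, IntegrableOn (f k) (Ioc 0 L)) (hg : IntegrableOn g (Ioc 0 L))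
    (hT : Tendsto (fun k => ∫ s in Ioc 0 L, |f k s - g s|) atTop (𝓝 0))
    {w : ℝ → ℝ} (hw : Continuous w) {C : ℝ} (hC : ∀ s, |w s| ≤ C) :
    Tendsto (fun k => ∫ s in Ioc 0 L, w s * f k s) atTop (𝓝 (∫ s in Ioc 0 L, w s * g s)) := by
  have hwi : ∀ {u : ℝ → ℝ}, IntegrableOn u (Ioc 0 L) → IntegrableOn (fun s => w s * u s) (Ioc 0 L) :=
    fun hu => hu.bdd_mul (c := C) hw.aestronglyMeasurable
      (Eventually.of_forall fun s => by rw [Real.norm_eq_abs]; exact hC s)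
  refine tendsto_iff_norm_sub_tendsto_zero.2 ?_
  have hC0 : 0 ≤ C := (abs_nonneg _).trans (hC 0)
  refine squeeze_zero (fun k => norm_nonneg _) (fun k => ?_) (by simpa using hT.const_mul C)
  rw [Real.norm_eq_abs, ← integral_sub (hwi (hf k)) (hwi hg)]
  calc |∫ s in Ioc 0 L, w s * f k s - w s * g s|
      ≤ ∫ s in Ioc 0 L, |w s * f k s - w s * g s| := abs_integral_le_integral_abs
    _ ≤ ∫ s in Ioc 0 L, C * |f k s - g s| := by
        refine setIntegral_mono_on ((hwi (hf k)).sub (hwi hg)).abs (((hf k).sub hg).abs.const_mul C)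
          measurableSet_Ioc fun s _ => ?_
        rw [← mul_sub, abs_mul]
        exact mul_le_mul_of_nonneg_right (hC s) (abs_nonneg _)
    _ = C * ∫ s in Ioc 0 L, |f k s - g s| := integral_const_mul _ _

/-- Pairing with a bounded continuous weight is continuous for uniform convergence on `[0, L]`.
[folklore] -/
theorem tendsto_setIntegral_mul_of_uniform (hL : 0 ≤ L) (M : ℕ → ℝ → ℝ) (m : ℝ → ℝ)
    (hM : ∀ k, ContinuousOn (M k) (Icc 0 L)) (hm : ContinuousOn m (Icc 0 L))
    (α : ℕ → ℝ) (hα : Tendsto α atTop (𝓝 0)) (hMm : ∀ k, ∀ s ∈ Icc 0 L, |M k s - m s| ≤ α k)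
    {w : ℝ → ℝ} (hw : Continuous w) {C : ℝ} (hC : ∀ s, |w s| ≤ C) :
    Tendsto (fun k => ∫ s in Ioc 0 L, w s * M k s) atTop (𝓝 (∫ s in Ioc 0 L, w s * m s)) := by
  have hwi : ∀ {u : ℝ → ℝ}, ContinuousOn u (Icc 0 L) → IntegrableOn (fun s => w s * u s) (Ioc 0 L) :=
    fun hu => ((hw.continuousOn.mul hu).integrableOn_Icc (μ := volume)).mono_set Ioc_subset_Icc_self
  refine tendsto_iff_norm_sub_tendsto_zero.2 ?_
  have hC0 : 0 ≤ C := (abs_nonneg _).trans (hC 0)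
  have hlim : Tendsto (fun k => C * α k * L) atTop (𝓝 0) := by
    simpa using (hα.const_mul C).mul_const L
  refine squeeze_zero (fun k => norm_nonneg _) (fun k => ?_) hlim
  rw [← integral_sub (hwi (hM k)) (hwi hm)]
  have hvol : volume.real (Ioc 0 L) = L := by simp [Measure.real, hL]
  have := norm_setIntegral_le_of_norm_le_const (s := Ioc 0 L) (μ := volume)
    (f := fun s => w s * M k s - w s * m s) (C := C * α k) (by simp) (fun s hs => ?_)
  · rw [hvol] at this
    exact this
  · rw [← mul_sub, norm_mul, Real.norm_eq_abs, Real.norm_eq_abs]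
    exact mul_le_mul (hC s) (hMm k s (Ioc_subset_Icc_self hs)) (abs_nonneg _) hC0

/-! ### Passing to the limit in the virial identity and in the slice bound -/

/-- Rescaling a bounded `C¹` test function to `|g̃| ≤ 1`: bookkeeping. [folklore] -/
theorem scaled_test {ĝ : ℝ → ℝ} (hĝ : ContDiff ℝ 1 ĝ) {C D : ℝ} (hC : 0 ≤ C)
    (hCb : ∀ s, |ĝ s| ≤ C) (hDb : ∀ s, |deriv ĝ s| ≤ D) :
    ContDiff ℝ 1 (fun s => ĝ s / (C + 1)) ∧ (∀ s, |ĝ s / (C + 1)| ≤ 1) ∧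
      (∀ s, deriv (fun s => ĝ s / (C + 1)) s = deriv ĝ s / (C + 1)) ∧
      (∀ s, |deriv (fun s => ĝ s / (C + 1)) s| ≤ D / (C + 1)) := by
  have hc : 0 < C + 1 := by linarith
  have hderiv : ∀ s, deriv (fun s => ĝ s / (C + 1)) s = deriv ĝ s / (C + 1) := fun s => by
    rw [deriv_div_const]
  refine ⟨hĝ.div_const _, fun s => ?_, hderiv, fun s => ?_⟩
  · rw [abs_div, abs_of_pos hc, div_le_one hc]
    exact (hCb s).trans (by linarith)
  · rw [hderiv, abs_div, abs_of_pos hc]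
    exact div_le_div_of_nonneg_right (hDb s) hc.le

/-- **The exact virial identity in the limit.** If the data `(Mₖ, Pₖ, Eₖ)` satisfy the approximate
identity `|∫₀ᴸ g Eₖ + ½∫₀ᴸ g' Pₖ - εₖ ∫₀ᴸ g Mₖ| ≤ ω(D)ₖ → 0` for all `C¹` tests with `|g| ≤ 1`,
`|g'| ≤ D`, and `Eₖ → e`, `Pₖ → p` in `L¹(0,L)`, `Mₖ → m` uniformly on `[0,L]`, `εₖ → E'`, then
`∫₀ᴸ g e + ½∫₀ᴸ g' p = E' ∫₀ᴸ g m` for every `C¹` test `g`. [folklore] -/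
theorem virialIdentity_of_limit (hL : 0 ≤ L) (M P E : ℕ → ℝ → ℝ) (m p e : ℝ → ℝ) (ε : ℕ → ℝ)
    (E' : ℝ) (ω : ℝ → ℕ → ℝ) (hω : ∀ D, Tendsto (ω D) atTop (𝓝 0)) (hε : Tendsto ε atTop (𝓝 E'))
    (hP : ∀ k, IntegrableOn (P k) (Ioc 0 L)) (hE : ∀ k, IntegrableOn (E k) (Ioc 0 L))
    (hp : IntegrableOn p (Ioc 0 L)) (he : IntegrableOn e (Ioc 0 L))
    (hM : ∀ k, ContinuousOn (M k) (Icc 0 L)) (hm : ContinuousOn m (Icc 0 L))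
    (hPT : Tendsto (fun k => ∫ s in Ioc 0 L, |P k s - p s|) atTop (𝓝 0))
    (hET : Tendsto (fun k => ∫ s in Ioc 0 L, |E k s - e s|) atTop (𝓝 0))
    (α : ℕ → ℝ) (hα : Tendsto α atTop (𝓝 0)) (hMm : ∀ k, ∀ s ∈ Icc 0 L, |M k s - m s| ≤ α k)
    (hvir : ∀ g : ℝ → ℝ, ContDiff ℝ 1 g → (∀ s, |g s| ≤ 1) → ∀ D : ℝ, 0 ≤ D →
      (∀ s, |deriv g s| ≤ D) → ∀ k,
      |(∫ s in (0:ℝ)..L, g s * E k s) + (1 / 2) * (∫ s in (0:ℝ)..L, deriv g s * P k s) -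
          ε k * ∫ s in (0:ℝ)..L, g s * M k s| ≤ ω D k) :
    ∀ g : ℝ → ℝ, ContDiff ℝ 1 g →
      (∫ s in (0:ℝ)..L, g s * e s) + (1 / 2) * (∫ s in (0:ℝ)..L, deriv g s * p s) =
        E' * ∫ s in (0:ℝ)..L, g s * m s := by
  intro g hg
  obtain ⟨ĝ, hĝ, heq, hdeq, ⟨C, hC, hCb⟩, ⟨D, hD, hDb⟩, -⟩ :=
    exists_contDiff_bounded_extension g hg hL
  obtain ⟨hgt, hgt1, hgtd, hgtD⟩ := scaled_test hĝ hC hCb hDb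
  set gt : ℝ → ℝ := fun s => ĝ s / (C + 1) with hgt_def
  have hc : 0 < C + 1 := by linarith
  have hgtc : Continuous gt := hgt.continuous
  have hgtdc : Continuous (deriv gt) := hgt.continuous_deriv le_rfl
  -- the approximate identity along the sequence, in set-integral form
  set A : ℕ → ℝ := fun k => (∫ s in Ioc 0 L, gt s * E k s) +
    (1 / 2) * (∫ s in Ioc 0 L, deriv gt s * P k s) - ε k * ∫ s in Ioc 0 L, gt s * M k s with hA
  have hAω : ∀ k, |A k| ≤ ω (D / (C + 1)) k := fun k => by
    have := hvir gt hgt hgt1 (D / (C + 1)) (div_nonneg hD hc.le) hgtD k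
    simpa only [intervalIntegral.integral_of_le hL] using this
  have hA0 : Tendsto A atTop (𝓝 0) :=
    squeeze_zero_norm (fun k => by rw [Real.norm_eq_abs]; exact hAω k) (hω _)
  -- the limit of `A`
  have hT1 := tendsto_setIntegral_mul_of_L1 E e hE he hET hgtc hgt1
  have hT2 := tendsto_setIntegral_mul_of_L1 P p hP hp hPT hgtdc hgtD
  have hT3 := tendsto_setIntegral_mul_of_uniform hL M m hM hm α hα hMm hgtc hgt1
  have hAlim : Tendsto A atTop (𝓝 ((∫ s in Ioc 0 L, gt s * e s) +
      (1 / 2) * (∫ s in Ioc 0 L, deriv gt s * p s) - E' * ∫ s in Ioc 0 L, gt s * m s)) :=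
    (hT1.add (hT2.const_mul (1 / 2))).sub (hε.mul hT3)
  have hlim0 := tendsto_nhds_unique hAlim hA0
  -- undo the rescaling on `[0, L]`
  have h1 : ∫ s in Ioc 0 L, gt s * e s = (C + 1)⁻¹ * ∫ s in Ioc 0 L, g s * e s := by
    rw [← MeasureTheory.integral_const_mul]
    refine setIntegral_congr_fun measurableSet_Ioc fun s hs => ?_
    simp only [hgt_def, heq s (Ioc_subset_Icc_self hs)]
    ring
  have h2 : ∫ s in Ioc 0 L, deriv gt s * p s = (C + 1)⁻¹ * ∫ s in Ioc 0 L, deriv g s * p s := by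
    rw [← MeasureTheory.integral_const_mul]
    refine setIntegral_congr_fun measurableSet_Ioc fun s hs => ?_
    rw [hgtd s, hdeq s (Ioc_subset_Icc_self hs)]
    ring
  have h3 : ∫ s in Ioc 0 L, gt s * m s = (C + 1)⁻¹ * ∫ s in Ioc 0 L, g s * m s := by
    rw [← MeasureTheory.integral_const_mul]
    refine setIntegral_congr_fun measurableSet_Ioc fun s hs => ?_
    simp only [hgt_def, heq s (Ioc_subset_Icc_self hs)]
    ring
  rw [h1, h2, h3] at hlim0
  simp only [intervalIntegral.integral_of_le hL]
  have hc' : (C + 1)⁻¹ ≠ 0 := inv_ne_zero hc.ne'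
  have := hlim0
  field_simp at this
  linarith

/-- **The slice bound in the limit.** If `∫₀ᴸ g ETₖ + E₁ ∫₀ᴸ g Mₖ ≤ ∫₀ᴸ g Eₖ` for all `C¹` tests with
`0 ≤ g ≤ 1`, and `ETₖ → et`, `Eₖ → e` in `L¹(0,L)`, `Mₖ → m` uniformly on `[0,L]`, then
`∫₀ᴸ g et + E₁ ∫₀ᴸ g m ≤ ∫₀ᴸ g e` for every nonnegative `C¹` test `g`. [folklore] -/
theorem sliceBound_of_limit (hL : 0 ≤ L) (M ET E : ℕ → ℝ → ℝ) (m et e : ℝ → ℝ) (E₁ : ℝ)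
    (hETi : ∀ k, IntegrableOn (ET k) (Ioc 0 L)) (hE : ∀ k, IntegrableOn (E k) (Ioc 0 L))
    (het : IntegrableOn et (Ioc 0 L)) (he : IntegrableOn e (Ioc 0 L))
    (hM : ∀ k, ContinuousOn (M k) (Icc 0 L)) (hm : ContinuousOn m (Icc 0 L))
    (hETT : Tendsto (fun k => ∫ s in Ioc 0 L, |ET k s - et s|) atTop (𝓝 0))
    (hET : Tendsto (fun k => ∫ s in Ioc 0 L, |E k s - e s|) atTop (𝓝 0))
    (α : ℕ → ℝ) (hα : Tendsto α atTop (𝓝 0)) (hMm : ∀ k, ∀ s ∈ Icc 0 L, |M k s - m s| ≤ α k)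
    (hsb : ∀ g : ℝ → ℝ, ContDiff ℝ 1 g → (∀ s, 0 ≤ g s) → (∀ s, g s ≤ 1) → ∀ k,
      (∫ s in (0:ℝ)..L, g s * ET k s) + E₁ * (∫ s in (0:ℝ)..L, g s * M k s) ≤
        ∫ s in (0:ℝ)..L, g s * E k s) :
    ∀ g : ℝ → ℝ, ContDiff ℝ 1 g → (∀ s, 0 ≤ g s) →
      (∫ s in (0:ℝ)..L, g s * et s) + E₁ * (∫ s in (0:ℝ)..L, g s * m s) ≤
        ∫ s in (0:ℝ)..L, g s * e s := by
  intro g hg hg0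
  obtain ⟨ĝ, hĝ, heq, -, ⟨C, hC, hCb⟩, ⟨D, hD, hDb⟩, hnn⟩ :=
    exists_contDiff_bounded_extension g hg hL
  obtain ⟨hgt, hgt1, -, -⟩ := scaled_test hĝ hC hCb hDb
  set gt : ℝ → ℝ := fun s => ĝ s / (C + 1) with hgt_def
  have hc : 0 < C + 1 := by linarith
  have hgtc : Continuous gt := hgt.continuous
  have hgt0 : ∀ s, 0 ≤ gt s := fun s => div_nonneg (hnn hg0 s) hc.le
  have hgt1' : ∀ s, gt s ≤ 1 := fun s => (le_abs_self _).trans (hgt1 s)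
  have hT1 := tendsto_setIntegral_mul_of_L1 ET et hETi het hETT hgtc hgt1
  have hT2 := tendsto_setIntegral_mul_of_L1 E e hE he hET hgtc hgt1
  have hT3 := tendsto_setIntegral_mul_of_uniform hL M m hM hm α hα hMm hgtc hgt1
  have hle : (∫ s in Ioc 0 L, gt s * et s) + E₁ * (∫ s in Ioc 0 L, gt s * m s) ≤
      ∫ s in Ioc 0 L, gt s * e s := by
    refine le_of_tendsto_of_tendsto' (hT1.add (hT3.const_mul E₁)) hT2 fun k => ?_
    have := hsb gt hgt hgt0 hgt1' k
    simpa only [intervalIntegral.integral_of_le hL] using this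
  have hresc : ∀ u : ℝ → ℝ, ∫ s in Ioc 0 L, gt s * u s = (C + 1)⁻¹ * ∫ s in Ioc 0 L, g s * u s := by
    intro u
    rw [← MeasureTheory.integral_const_mul]
    refine setIntegral_congr_fun measurableSet_Ioc fun s hs => ?_
    simp only [hgt_def, heq s (Ioc_subset_Icc_self hs)]
    ring
  rw [hresc, hresc, hresc] at hle
  simp only [intervalIntegral.integral_of_le hL]
  have hci : 0 < (C + 1)⁻¹ := inv_pos.2 hc
  nlinarith [hle, hci]

end Literature.Analysis.FunctionSpaces

end
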